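import Literature.Combinatorics.Optimization.RationalPsdRank
import HarnessLib

/-!
# Octahedra with at most one planarity have psd rank at least five (Gouveia–Robinson–Thomas 2013, Thm. 4.8, converse) — PROVED for GRT's second normal form

Source: J. Gouveia, R. Z. Robinson, R. R. Thomas, *Polytopes of minimum positive semidefinite rank*,
Discrete Comput. Geom. 50 (2013) 679–699 = arXiv:1205.5306 [GouveiaRobinsonThomas2013], proof of
Theorem 4.8, second half (held text `paper:arxiv-1205.5306`, chunk p12). Companion of
`BiplanarOctahedraPsdRank.lean` (Theorem 4.8 for octahedra planar with respect to a coordinate plane: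
psd rank `4` iff biplanar, else `5`) and `OctahedronPsdRankFive.lean` (Example 4.5).

The printed text (p12, verbatim). "For the converse, suppose `O` is planar to either one or zero
planes. If a planar condition is satisfied, assume it is by the vertices `v₁,v₂,v₃,v₄`. By applying an
affine transformation, we can assume that `v₁ = (0,0,1)`, `v₂ = (0,0,0)`, `v₃ = (1,0,0)`, and
`v₅ = (0,1,0)`. Let `v₄ = (z₁,z₂,z₃)` and `v₆ = (w₁,w₂,w₃)` where we must have
`z₁ < 0, w₃ > 0, 1 − z₁ − z₂ − z₃ > 0, and 1 − w₁ − w₂ − w₃ > 0` (4) to preserve the combinatorial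
structure. (These are not all of the required conditions, but we will use these particular ones
below.) Since `O` cannot satisfy planarity conditions on the set of vertices `{v₁,v₂,v₅,v₆}` or
`{v₃,v₄,v₅,v₆}`, we must have that `w₁ ≠ 0 and w₁z₃ + w₂z₃ − z₁w₃ − z₂w₃ + w₃ − z₃ ≠ 0` (5). We
calculate the slack matrix `S_O` and consider its `5 × 5` submatrix `M` indexed by the vertices
`v₁,v₂,v₃,v₅,v₆` in the rows and the facets `F_{1,3,5}, F_{2,3,6}, F_{2,4,5}, F_{1,3,6}, F_{1,4,5}` in
the columns where `F_{i,j,k}` is the facet defined by the vertices `v_i,v_j,v_k`. After multiplying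
the rows and columns by nonnegative constants, `M` has the form:
`[[0,1,1,0,0],[1,0,0,1,1],[0,0,z₃,0,1−z₁−z₂−z₃],[0,w₃,0,1−w₁−w₂−w₃,0],
[−z₁(1−w₁−w₂−w₃),0,−z₁w₃+w₁z₃,0,−z₁(1−w₂−w₃)+w₁(1−z₂−z₃)]]`. Now consider an arbitrary Hadamard
square root `√M` … Now if `rank_psd O = 4`, then `rank_√ M ≤ 4` … Using Macaulay2 [M2], we can compute
a set of generators of `I:J` and by elimination one sees that
`f = z₁w₁w₃(w₁+w₂+w₃−1)(z₁+z₂+z₃−1)(w₁z₃+w₂z₃−z₁w₃−z₂w₃+w₃−z₃)` lies in `I:J`. However, no choice of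
`z₁,…,w₃` that is required to satisfy (4) and (5) can vanish on `f`. Hence, we must have
`rank_psd O ≥ 5`."

What is PROVED here (the Macaulay2 step replaced by an explicit, sign-free elimination):

| claim | Lean | status |
|---|---|---|
| `M` is the slack matrix of `v₁,v₂,v₃,v₅,v₆` against the five facets `F₁₃₅,F₂₃₆,F₂₄₅,F₁₃₆,F₁₄₅` "after multiplying the rows and columns by nonnegative constants" (explicit inequalities and explicit positive scalings) | `nonplanarOctahedronVertices`, `nonplanarOctahedronNormals`, `nonplanarOctahedronOffsets`, `nonplanarOctahedron_slack_eq_scaled` | PROVED |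
| under (4), (5) and `z₃ > 0` (the slack of `v₄` off `F₂₃₅`): EVERY Hadamard square root of `M` is nonsingular ("there must exist real numbers `x₁,…,x₇` … no choice … can vanish on `f`") | `NonplanarOctahedronHyp.linearIndependent_rows_of_sq_eq`, `.rank_eq_five_of_sq_eq`, **`.not_hasHadamardSqrtOfRankLE_four`** | PROVED |
| "Now if `rank_psd O = 4`, then `rank_√ M ≤ 4` … Hence, we must have `rank_psd O ≥ 5`": every nonnegative `6 × 8` matrix with the octahedral zero pattern whose `5 × 5` submatrix on rows `v₁,v₂,v₃,v₅,v₆` / columns `F₁₃₅,F₂₃₆,F₂₄₅,F₁₃₆,F₁₄₅` is a positive rescaling of `M` has NO psd factorization of size `4` | `nonplanarSupport`, `factors_rank_le_one_of_nonplanarSupport`, **`NonplanarOctahedronHyp.not_hasPsdFactorization_four`**, `GouveiaRobinsonThomas2013_thm48_converse` | PROVED |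

The elimination. Let `N ∘ N = M` and suppose `Σ pᵢ rᵢ = 0` on the rows of `N`. The columns give
`p₁ = −p₄N₄₀N₁₀`, `p₃ W = p₄N₄₀N₃₃N₁₃N₁₀` (`W = 1−w₁−w₂−w₃ = N₃₃²`), `p₀ = −p₃N₃₁N₀₁`, and two
expressions for `p₂`; eliminating, `p₄ · N₃₃ · Φ = 0` with
`Φ = N₂₄(𝒞 − 𝒟) − N₂₂N₃₃(𝒜 − ℬ)`, `𝒜 = N₁₀N₁₄N₄₀`, `ℬ = N₄₄`, `𝒞 = N₀₁N₀₂N₁₀N₁₃N₃₁N₄₀`,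
`𝒟 = N₃₃N₄₂` (for the positive square root, `Φ = −det √M`; cf. the printed `det S`). The squares are
entries of `M`: `ℬ² − 𝒜² = w₁(1−z₁−z₂−z₃)`, `𝒟² − 𝒞² = w₁z₃(1−w₁−w₂−w₃)`, `N₂₄² = 1−z₁−z₂−z₃`,
`(N₂₂N₃₃)² = z₃(1−w₁−w₂−w₃)`; so `Φ = 0` forces
`(𝒜 − ℬ)·(N₂₄(𝒞 + 𝒟) − N₂₂N₃₃(𝒜 + ℬ)) = 0`, and `𝒜 = ℬ` gives `w₁ = 0`, while the other factor
gives `N₂₄𝒞 = N₂₂N₃₃𝒜`, whose square is `−z₁(1−w₁−w₂−w₃)·(w₃(1−z₁−z₂−z₃) − z₃(1−w₁−w₂−w₃)) = 0`,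
i.e. the third planarity `w₁z₃+w₂z₃−z₁w₃−z₂w₃+w₃−z₃ = 0`. Under (5) therefore `Φ ≠ 0`, all `pᵢ`
vanish, and `rank N = 5`: exactly the printed conclusion `rank_√ M ≥ 5`, for every sign pattern.

NOT typed: the affine normalization of an arbitrary octahedron to this normal form, and the
computation of the full `6 × 8` slack matrix `S_O` of the normal form (only its `5 × 5` block `M` is
printed); the final step is therefore typed for every nonnegative `6 × 8` matrix with the octahedral
zero pattern containing a positive rescaling of `M` in that position — which is what "We calculate
the slack matrix `S_O` and consider its `5 × 5` submatrix `M`" provides — using GRT Prop. 3.2's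
rank-one factors in the pattern form of the tree (`rank_rowFactor_add_le_of_triangular`).
-/

noncomputable section

open Matrix Finset
open scoped MatrixOrder

namespace Literature.Combinatorics.Optimization

/-! ### The second normal form and the matrix `M` -/

/-- `1 − z₁ − z₂ − z₃` (coordinates `z = (z 0, z 1, z 2) = (z₁,z₂,z₃)`).
[cite: GouveiaRobinsonThomas2013, Thm. 4.8 proof (p12, (4))] -/
def octaRest (z : Fin 3 → ℝ) : ℝ := 1 - z 0 - z 1 - z 2

/-- The third planarity polynomial `w₁z₃ + w₂z₃ − z₁w₃ − z₂w₃ + w₃ − z₃` (vertices `v₃,v₄,v₅,v₆`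
coplanar). [cite: GouveiaRobinsonThomas2013, Thm. 4.8 proof (p12, (5))] -/
def octaP3 (z w : Fin 3 → ℝ) : ℝ := w 0 * z 2 + w 1 * z 2 - z 0 * w 2 - z 1 * w 2 + w 2 - z 2

/-- **The `5 × 5` matrix `M` of GRT's proof of Theorem 4.8** (p12, verbatim display quoted in the
module docstring): rows `v₁,v₂,v₃,v₅,v₆`, columns `F₁₃₅,F₂₃₆,F₂₄₅,F₁₃₆,F₁₄₅`.
[cite: GouveiaRobinsonThomas2013, Thm. 4.8 proof (p12)] -/
def nonplanarOctahedronM (z w : Fin 3 → ℝ) : Matrix (Fin 5) (Fin 5) ℝ :=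
  !![0, 1, 1, 0, 0;
     1, 0, 0, 1, 1;
     0, 0, z 2, 0, octaRest z;
     0, w 2, 0, octaRest w, 0;
     -z 0 * octaRest w, 0, -z 0 * w 2 + w 0 * z 2, 0, -z 0 * (1 - w 1 - w 2) + w 0 * (1 - z 1 - z 2)]

/-- The six vertices of the second normal form: `v₁ = (0,0,1)`, `v₂ = (0,0,0)`, `v₃ = (1,0,0)`,
`v₄ = z`, `v₅ = (0,1,0)`, `v₆ = w`. [cite: GouveiaRobinsonThomas2013, Thm. 4.8 proof (p12)] -/
def nonplanarOctahedronVertices (z w : Fin 3 → ℝ) : Fin 6 → Fin 3 → ℝ :=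
  ![![0, 0, 1], ![0, 0, 0], ![1, 0, 0], z, ![0, 1, 0], w]

/-- The five facet inequalities `a_jᵀx ≤ b_j` of the columns of `M` (normals): `F₁₃₅ : x+y+z ≤ 1`,
`F₂₃₆ : −w₃y + w₂z ≤ 0`, `F₂₄₅ : −z₃x + z₁z ≤ 0`, `F₁₃₆ : −w₂x − (1−w₁−w₃)y − w₂z ≤ −w₂`,
`F₁₄₅ : −(1−z₂−z₃)x − z₁y − z₁z ≤ −z₁` (each plane passes through the three named vertices).
[cite: GouveiaRobinsonThomas2013, Thm. 4.8 proof (p12)] -/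
def nonplanarOctahedronNormals (z w : Fin 3 → ℝ) : Fin 5 → Fin 3 → ℝ :=
  ![![1, 1, 1], ![0, -w 2, w 1], ![-z 2, 0, z 0], ![-w 1, -(1 - w 0 - w 2), -w 1],
    ![-(1 - z 1 - z 2), -z 0, -z 0]]

/-- The five facet inequalities: right-hand sides `1, 0, 0, −w₂, −z₁`.
[cite: GouveiaRobinsonThomas2013, Thm. 4.8 proof (p12)] -/
def nonplanarOctahedronOffsets (z w : Fin 3 → ℝ) : Fin 5 → ℝ := ![1, 0, 0, -w 1, -z 0]

/-- "We calculate the slack matrix `S_O` and consider its `5 × 5` submatrix `M` … After multiplying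
the rows and columns by nonnegative constants, `M` has the form": the slack matrix of the vertices
`v₁,v₂,v₃,v₅,v₆` (rows `0,1,2,4,5` of `nonplanarOctahedronVertices`) against the five inequalities
is `r_i · M_{ij} · c_j` with the explicit scalings `r = (−z₁, −z₁, 1, z₁/w₂, 1)`,
`c = (−1/z₁, w₂/z₁, 1, w₂/z₁, 1)` — positive when `z₁ < 0` and `w₂ < 0` (the slack of `v₁` off
`F₂₃₆` is `−w₂`). [cite: GouveiaRobinsonThomas2013, Thm. 4.8 proof (p12)] -/
theorem nonplanarOctahedron_slack_eq_scaled {z w : Fin 3 → ℝ} (hz : z 0 ≠ 0) (hw : w 1 ≠ 0)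
    (i j : Fin 5) :
    nonplanarOctahedronOffsets z w j -
        nonplanarOctahedronNormals z w j ⬝ᵥ nonplanarOctahedronVertices z w ((![0, 1, 2, 4, 5] : Fin 5 → Fin 6) i) =
      (![-z 0, -z 0, 1, z 0 / w 1, 1] : Fin 5 → ℝ) i * nonplanarOctahedronM z w i j *
        (![-1 / z 0, w 1 / z 0, 1, w 1 / z 0, 1] : Fin 5 → ℝ) j := by
  fin_cases i <;> fin_cases j <;>
    simp [nonplanarOctahedronOffsets, nonplanarOctahedronNormals, nonplanarOctahedronVertices,
      nonplanarOctahedronM, octaRest, dotProduct, Fin.sum_univ_three] <;>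
    field_simp <;> ring

/-- The hypotheses of the printed converse argument: the conditions (4) `z₁ < 0`, `w₃ > 0`,
`1−z₁−z₂−z₃ > 0`, `1−w₁−w₂−w₃ > 0`, the slack `z₃ > 0` of `v₄` off the facet `F₂₃₅` (one of the
"required conditions" not listed in (4); it makes the `(3,3)` entry of `M` positive), and the two
planarity violations (5) `w₁ ≠ 0`, `w₁z₃+w₂z₃−z₁w₃−z₂w₃+w₃−z₃ ≠ 0`. (The entries `−z₁w₃+w₁z₃` and
`−z₁(1−w₂−w₃)+w₁(1−z₂−z₃)` of `M` are also slacks, hence positive for a genuine octahedron; their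
signs are not needed below.) [cite: GouveiaRobinsonThomas2013, Thm. 4.8 proof (p12, (4)–(5))] -/
structure NonplanarOctahedronHyp (z w : Fin 3 → ℝ) : Prop where
  z1_neg : z 0 < 0
  z3_pos : 0 < z 2
  w3_pos : 0 < w 2
  restz_pos : 0 < octaRest z
  restw_pos : 0 < octaRest w
  w1_ne : w 0 ≠ 0
  p3_ne : octaP3 z w ≠ 0

/-! ### Every Hadamard square root of `M` is nonsingular -/

namespace NonplanarOctahedronHyp

variable {z w : Fin 3 → ℝ} (h : NonplanarOctahedronHyp z w)
include h

-- one long elimination (25 matrix entries as atoms, products of degree ≤ 9 in `linear_combination`)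
set_option maxHeartbeats 800000 in
/-- **The heart of the converse** (p12: "Now if `rank_psd O = 4`, then `rank_√ M ≤ 4` and, hence,
there must exist real numbers `x₁,…,x₇` … However, no choice of `z₁,…,w₃` that is required to
satisfy (4) and (5) can vanish on `f`"): for EVERY real `N` with `N ∘ N = M` (any of the `2¹²` sign
patterns), the five rows of `N` are linearly independent. Proof: the sign-free elimination of the
module docstring. [cite: GouveiaRobinsonThomas2013, Thm. 4.8 proof (p12)] -/
theorem linearIndependent_rows_of_sq_eq (N : Matrix (Fin 5) (Fin 5) ℝ)
    (hN : ∀ i j, N i j ^ 2 = nonplanarOctahedronM z w i j) : LinearIndependent ℝ N.row := by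
  have hz1 := h.z1_neg; have hz3 := h.z3_pos; have hw3 := h.w3_pos
  have hZ := h.restz_pos; have hW := h.restw_pos
  rw [Fintype.linearIndependent_iff]
  intro g hg
  have hcol : ∀ j, g 0 * N 0 j + g 1 * N 1 j + g 2 * N 2 j + g 3 * N 3 j + g 4 * N 4 j = 0 := by
    intro j
    have := congrFun hg j
    simpa [Fin.sum_univ_five, Matrix.row] using this
  -- zero entries
  have hzr : ∀ i j, nonplanarOctahedronM z w i j = 0 → N i j = 0 := fun i j hij => by
    have := hN i j
    rw [hij] at this
    exact (pow_eq_zero_iff two_ne_zero).mp this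
  have z00 : N 0 0 = 0 := hzr 0 0 (by simp [nonplanarOctahedronM])
  have z03 : N 0 3 = 0 := hzr 0 3 (by simp [nonplanarOctahedronM])
  have z04 : N 0 4 = 0 := hzr 0 4 (by simp [nonplanarOctahedronM])
  have z11 : N 1 1 = 0 := hzr 1 1 (by simp [nonplanarOctahedronM])
  have z12 : N 1 2 = 0 := hzr 1 2 (by simp [nonplanarOctahedronM])
  have z20 : N 2 0 = 0 := hzr 2 0 (by simp [nonplanarOctahedronM])
  have z21 : N 2 1 = 0 := hzr 2 1 (by simp [nonplanarOctahedronM])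
  have z23 : N 2 3 = 0 := hzr 2 3 (by simp [nonplanarOctahedronM])
  have z30 : N 3 0 = 0 := hzr 3 0 (by simp [nonplanarOctahedronM])
  have z32 : N 3 2 = 0 := hzr 3 2 (by simp [nonplanarOctahedronM])
  have z34 : N 3 4 = 0 := hzr 3 4 (by simp [nonplanarOctahedronM])
  have z41 : N 4 1 = 0 := hzr 4 1 (by simp [nonplanarOctahedronM])
  have z43 : N 4 3 = 0 := hzr 4 3 (by simp [nonplanarOctahedronM])
  -- squares
  have e01 : N 0 1 ^ 2 = 1 := by rw [hN]; simp [nonplanarOctahedronM]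
  have e02 : N 0 2 ^ 2 = 1 := by rw [hN]; simp [nonplanarOctahedronM]
  have e10 : N 1 0 ^ 2 = 1 := by rw [hN]; simp [nonplanarOctahedronM]
  have e13 : N 1 3 ^ 2 = 1 := by rw [hN]; simp [nonplanarOctahedronM]
  have e14 : N 1 4 ^ 2 = 1 := by rw [hN]; simp [nonplanarOctahedronM]
  have e22 : N 2 2 ^ 2 = z 2 := by rw [hN]; simp [nonplanarOctahedronM]
  have e24 : N 2 4 ^ 2 = octaRest z := by rw [hN]; simp [nonplanarOctahedronM]
  have e31 : N 3 1 ^ 2 = w 2 := by rw [hN]; simp [nonplanarOctahedronM]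
  have e33 : N 3 3 ^ 2 = octaRest w := by rw [hN]; simp [nonplanarOctahedronM]
  have e40 : N 4 0 ^ 2 = -z 0 * octaRest w := by rw [hN]; simp [nonplanarOctahedronM]
  have e42 : N 4 2 ^ 2 = -z 0 * w 2 + w 0 * z 2 := by rw [hN]; simp [nonplanarOctahedronM]
  have e44 : N 4 4 ^ 2 = -z 0 * (1 - w 1 - w 2) + w 0 * (1 - z 1 - z 2) := by
    rw [hN]; simp [nonplanarOctahedronM]
  -- coefficients
  obtain ⟨p0, hp0⟩ : ∃ p, p = g 0 := ⟨_, rfl⟩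
  obtain ⟨p1, hp1⟩ : ∃ p, p = g 1 := ⟨_, rfl⟩
  obtain ⟨p2, hp2⟩ : ∃ p, p = g 2 := ⟨_, rfl⟩
  obtain ⟨p3, hp3⟩ : ∃ p, p = g 3 := ⟨_, rfl⟩
  obtain ⟨p4, hp4⟩ : ∃ p, p = g 4 := ⟨_, rfl⟩
  rw [← hp0, ← hp1, ← hp2, ← hp3, ← hp4] at hcol
  have c0 : p1 * N 1 0 + p4 * N 4 0 = 0 := by have := hcol 0; rw [z00, z20, z30] at this; linarith
  have c1 : p0 * N 0 1 + p3 * N 3 1 = 0 := by have := hcol 1; rw [z11, z21, z41] at this; linarith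
  have c2 : p0 * N 0 2 + p2 * N 2 2 + p4 * N 4 2 = 0 := by
    have := hcol 2; rw [z12, z32] at this; linarith
  have c3 : p1 * N 1 3 + p3 * N 3 3 = 0 := by have := hcol 3; rw [z03, z23, z43] at this; linarith
  have c4 : p1 * N 1 4 + p2 * N 2 4 + p4 * N 4 4 = 0 := by
    have := hcol 4; rw [z04, z34] at this; linarith
  -- `p₁ = −p₃N₃₃N₁₃`, `p₀ = −p₃N₃₁N₀₁`, `p₄N₄₀ = p₃N₃₃N₁₃N₁₀`
  have hp1' : p1 = -(p3 * N 3 3 * N 1 3) := by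
    have : p1 * N 1 3 ^ 2 + p3 * N 3 3 * N 1 3 = 0 := by linear_combination N 1 3 * c3
    rw [e13] at this; linarith
  have hp0' : p0 = -(p3 * N 3 1 * N 0 1) := by
    have : p0 * N 0 1 ^ 2 + p3 * N 3 1 * N 0 1 = 0 := by linear_combination N 0 1 * c1
    rw [e01] at this; linarith
  have hp4' : p4 * N 4 0 = p3 * N 3 3 * N 1 3 * N 1 0 := by
    have : p1 * N 1 0 + p4 * N 4 0 = 0 := c0
    rw [hp1'] at this; linarith
  -- the signed products
  obtain ⟨A, hA⟩ : ∃ A, A = N 1 0 * N 1 4 * N 4 0 := ⟨_, rfl⟩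
  obtain ⟨B, hB⟩ : ∃ B, B = N 4 4 := ⟨_, rfl⟩
  obtain ⟨C, hC⟩ : ∃ C, C = N 0 1 * N 0 2 * N 1 0 * N 1 3 * N 3 1 * N 4 0 := ⟨_, rfl⟩
  obtain ⟨D, hD⟩ : ∃ D, D = N 3 3 * N 4 2 := ⟨_, rfl⟩
  obtain ⟨K, hK⟩ : ∃ K, K = N 2 2 * N 3 3 := ⟨_, rfl⟩
  have hBA : B ^ 2 - A ^ 2 = w 0 * octaRest z := by
    have : A ^ 2 = N 1 0 ^ 2 * N 1 4 ^ 2 * N 4 0 ^ 2 := by rw [hA]; ring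
    rw [this, hB, e10, e14, e40, e44]
    simp only [octaRest]; ring
  have hDC : D ^ 2 - C ^ 2 = w 0 * z 2 * octaRest w := by
    have h1 : C ^ 2 = N 0 1 ^ 2 * N 0 2 ^ 2 * N 1 0 ^ 2 * N 1 3 ^ 2 * N 3 1 ^ 2 * N 4 0 ^ 2 := by
      rw [hC]; ring
    have h2 : D ^ 2 = N 3 3 ^ 2 * N 4 2 ^ 2 := by rw [hD]; ring
    rw [h1, h2, e01, e02, e10, e13, e31, e40, e33, e42]; ring
  have hK2 : K ^ 2 = z 2 * octaRest w := by
    have : K ^ 2 = N 2 2 ^ 2 * N 3 3 ^ 2 := by rw [hK]; ring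
    rw [this, e22, e33]
  -- elimination: `p₄ · N₃₃ · Φ = 0`, `Φ = N₂₄(C − D) − K(A − B)`
  have hΦ : p4 * N 3 3 * (N 2 4 * (C - D) - K * (A - B)) = 0 := by
    -- `p₃W = p₄N₄₀N₃₃N₁₃N₁₀` with `W = N₃₃²`
    have h33 : p3 * N 3 3 ^ 2 = p4 * N 4 0 * N 3 3 * N 1 3 * N 1 0 := by
      have : p4 * N 4 0 * N 3 3 * N 1 3 * N 1 0 = p3 * N 3 3 ^ 2 * N 1 3 ^ 2 * N 1 0 ^ 2 := by
        rw [hp4']; ring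
      rw [this, e13, e10]; ring
    -- the two expressions for `p₂`
    have h2' : p2 * N 2 2 = p3 * N 3 1 * N 0 1 * N 0 2 - p4 * N 4 2 := by
      have : p2 * N 2 2 = -(p0 * N 0 2) - p4 * N 4 2 := by linarith
      rw [this, hp0']; ring
    have h4' : p2 * N 2 4 = p3 * N 3 3 * N 1 3 * N 1 4 - p4 * N 4 4 := by
      have : p2 * N 2 4 = -(p1 * N 1 4) - p4 * N 4 4 := by linarith
      rw [this, hp1']; ring
    -- cross-multiply, scale by `N₃₃²`, and use `p₃N₃₃² = p₄N₄₀N₃₃N₁₃N₁₀`, `N₁₃² = 1`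
    rw [hA, hB, hC, hD, hK]
    linear_combination (-(N 3 3 ^ 2 * N 2 4)) * h2' + (N 3 3 ^ 2 * N 2 2) * h4' +
      (N 2 2 * N 3 3 * N 1 4 * N 1 3 - N 2 4 * N 0 1 * N 0 2 * N 3 1) * h33 +
      (p4 * N 2 2 * N 3 3 ^ 2 * N 1 4 * N 4 0 * N 1 0) * e13
  -- `Φ ≠ 0`
  have hΦne : N 2 4 * (C - D) - K * (A - B) ≠ 0 := by
    intro hΦ0
    have hKne : K ≠ 0 := by
      intro hK0
      rw [hK0] at hK2
      have h0 : (0 : ℝ) ^ 2 = 0 := by norm_num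
      linarith [hK2, mul_pos hz3 hW]
    -- `K · (A − B) · (N₂₄(C + D) − K(A + B)) = 0`
    have hT : K * ((A - B) * (N 2 4 * (C + D) - K * (A + B))) = 0 := by
      have h1 : K * (A - B) = N 2 4 * (C - D) := by linarith
      have : K * ((A - B) * (N 2 4 * (C + D) - K * (A + B))) =
          N 2 4 ^ 2 * (C ^ 2 - D ^ 2) + K ^ 2 * (B ^ 2 - A ^ 2) := by
        linear_combination (N 2 4 * (C + D)) * h1
      rw [this, e24, hK2, hBA]
      linear_combination (-(octaRest z)) * hDC
    rcases mul_eq_zero.mp ((mul_eq_zero.mp hT).resolve_left hKne) with hAB | hsum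
    · -- `A = B`: `w₁ (1−z₁−z₂−z₃) = 0`
      have : B ^ 2 - A ^ 2 = 0 := by rw [sub_eq_zero.mp hAB]; ring
      rw [hBA] at this
      rcases mul_eq_zero.mp this with h0 | h0
      · exact h.w1_ne h0
      · linarith
    · -- `N₂₄ C = K A`: squaring gives `−z₁W · (w₃Z − z₃W) = 0`, the third planarity
      have hCA : N 2 4 * C = K * A := by linarith
      have hsq : N 2 4 ^ 2 * C ^ 2 = K ^ 2 * A ^ 2 := by
        have := congrArg (· ^ 2) hCA; simpa [mul_pow] using this
      have hC2 : C ^ 2 = w 2 * (-z 0 * octaRest w) := by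
        have h1 : C ^ 2 = N 0 1 ^ 2 * N 0 2 ^ 2 * N 1 0 ^ 2 * N 1 3 ^ 2 * N 3 1 ^ 2 * N 4 0 ^ 2 := by
          rw [hC]; ring
        rw [h1, e01, e02, e10, e13, e31, e40]; ring
      have hA2 : A ^ 2 = -z 0 * octaRest w := by
        have : A ^ 2 = N 1 0 ^ 2 * N 1 4 ^ 2 * N 4 0 ^ 2 := by rw [hA]; ring
        rw [this, e10, e14, e40]; ring
      rw [e24, hK2, hC2, hA2] at hsq
      have hkey : (-z 0 * octaRest w) * (octaRest z * w 2 - z 2 * octaRest w) = 0 := by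
        linear_combination hsq
      have hne : -z 0 * octaRest w ≠ 0 := ne_of_gt (mul_pos (by linarith) hW)
      have h3 := (mul_eq_zero.mp hkey).resolve_left hne
      apply h.p3_ne
      have : octaP3 z w = octaRest z * w 2 - z 2 * octaRest w := by
        simp only [octaP3, octaRest]; ring
      rw [this, h3]
  -- conclude
  have hp4z : p4 = 0 := by
    have h33ne : N 3 3 ≠ 0 := by
      intro h0; rw [h0] at e33; linarith [e33]
    rcases mul_eq_zero.mp hΦ with h' | h'
    · rcases mul_eq_zero.mp h' with h'' | h''
      · exact h''
      · exact absurd h'' h33ne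
    · exact absurd h' hΦne
  have hp3z : p3 = 0 := by
    have h' : p3 * N 3 3 * N 1 3 * N 1 0 = 0 := by rw [← hp4', hp4z, zero_mul]
    have h33ne : N 3 3 ≠ 0 := by intro h0; rw [h0] at e33; linarith [e33]
    have h13ne : N 1 3 ≠ 0 := by intro h0; rw [h0] at e13; norm_num at e13
    have h10ne : N 1 0 ≠ 0 := by intro h0; rw [h0] at e10; norm_num at e10
    simpa [h33ne, h13ne, h10ne] using h'
  have hp1z : p1 = 0 := by rw [hp1', hp3z]; ring
  have hp0z : p0 = 0 := by rw [hp0', hp3z]; ring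
  have hp2z : p2 = 0 := by
    have h' : p2 * N 2 2 = 0 := by rw [hp0z, hp4z] at c2; linarith
    have h22ne : N 2 2 ≠ 0 := by intro h0; rw [h0] at e22; linarith [e22]
    simpa [h22ne] using h'
  intro k
  fin_cases k
  · simpa [← hp0] using hp0z
  · simpa [← hp1] using hp1z
  · simpa [← hp2] using hp2z
  · simpa [← hp3] using hp3z
  · simpa [← hp4] using hp4z

/-- Hence every Hadamard square root of `M` has rank `5` ("`rank_√ M ≤ 4`" is impossible).
[cite: GouveiaRobinsonThomas2013, Thm. 4.8 proof (p12)] -/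
theorem rank_eq_five_of_sq_eq (N : Matrix (Fin 5) (Fin 5) ℝ)
    (hN : ∀ i j, N i j ^ 2 = nonplanarOctahedronM z w i j) : N.rank = 5 := by
  simpa using (h.linearIndependent_rows_of_sq_eq N hN).rank_matrix

/-- `rank_√ M ≥ 5`: `M` has no Hadamard square root of rank `≤ 4`.
[cite: GouveiaRobinsonThomas2013, Thm. 4.8 proof (p12)] -/
theorem not_hasHadamardSqrtOfRankLE_four : ¬ HasHadamardSqrtOfRankLE (nonplanarOctahedronM z w) 4 := by
  rintro ⟨N, hN, hrk⟩
  have := h.rank_eq_five_of_sq_eq N hN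
  omega

end NonplanarOctahedronHyp

/-! ### From `M` to the whole slack matrix: psd rank at least five -/

/-- The octahedral support in the labelling of the second normal form: rows `v₁,…,v₆` (antipodal
pairs `{v₁,v₂}, {v₃,v₄}, {v₅,v₆}`), columns the facets `F₁₃₅,F₂₃₆,F₂₄₅,F₁₃₆,F₁₄₅,F₁₄₆,F₂₃₅,F₂₄₆`
(the five columns of `M` first); `0` = incidence. [cite: GouveiaRobinsonThomas2013, Thm. 4.8 proof (p12)] -/
def nonplanarSupport : Fin 6 → Fin 8 → ℕ :=
  ![![0, 1, 1, 0, 0, 0, 1, 1], ![1, 0, 0, 1, 1, 1, 0, 0], ![0, 0, 1, 0, 1, 1, 0, 1],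
    ![1, 1, 0, 1, 0, 0, 1, 0], ![0, 1, 0, 1, 0, 1, 0, 1], ![1, 0, 1, 0, 1, 0, 1, 0]]

/-- GRT Prop. 3.2 for this support (via Prop. 2.6's compression and triangular `3`-patterns): in a
psd factorization of size `4` of any matrix with the octahedral zero pattern `nonplanarSupport`,
every factor has rank `≤ 1`. [cite: GouveiaRobinsonThomas2013, Prop. 3.2 (p07), Thm. 4.8 proof (p12)] -/
theorem factors_rank_le_one_of_nonplanarSupport {S : Fin 6 → Fin 8 → ℝ}
    (hS : ∀ i j, S i j = 0 ↔ nonplanarSupport i j = 0) (A : Fin 6 → Matrix (Fin 4) (Fin 4) ℝ)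
    (B : Fin 8 → Matrix (Fin 4) (Fin 4) ℝ) (hA : ∀ i, (A i).PosSemidef) (hB : ∀ j, (B j).PosSemidef)
    (hM : ∀ i j, S i j = (A i * B j).trace) :
    (∀ i, (A i).rank ≤ 1) ∧ ∀ j, (B j).rank ≤ 1 := by
  have row : ∀ (r : Fin 6) (ρ : Fin 3 → Fin 6) (γ : Fin 3 → Fin 8),
      (∀ t, nonplanarSupport r (γ t) = 0) → (∀ t, nonplanarSupport (ρ t) (γ t) ≠ 0) →
      (∀ s t, s < t → nonplanarSupport (ρ s) (γ t) = 0) → (A r).rank ≤ 1 := by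
    intro r ρ γ h1 h2 h3
    have h' := rank_rowFactor_add_le_of_triangular A B hA hB hM r ρ γ
      (fun t => (hS _ _).mpr (h1 t)) (fun t ht => h2 t ((hS _ _).mp ht))
      (fun s t hst => (hS _ _).mpr (h3 s t hst))
    omega
  have col : ∀ (c : Fin 8) (ρ : Fin 3 → Fin 6) (γ : Fin 3 → Fin 8),
      (∀ t, nonplanarSupport (ρ t) c = 0) → (∀ t, nonplanarSupport (ρ t) (γ t) ≠ 0) →
      (∀ s t, s < t → nonplanarSupport (ρ s) (γ t) = 0) → (B c).rank ≤ 1 := by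
    intro c ρ γ h1 h2 h3
    have h' := rank_colFactor_add_le_of_triangular A B hA hB hM c ρ γ
      (fun t => (hS _ _).mpr (h1 t)) (fun t ht => h2 t ((hS _ _).mp ht))
      (fun s t hst => (hS _ _).mpr (h3 s t hst))
    omega
  refine ⟨fun i => ?_, fun j => ?_⟩
  · fin_cases i
    · exact row 0 ![5, 3, 1] ![0, 3, 5] (by decide) (by decide) (by decide)
    · exact row 1 ![4, 2, 0] ![1, 2, 6] (by decide) (by decide) (by decide)
    · exact row 2 ![5, 0, 1] ![0, 1, 3] (by decide) (by decide) (by decide)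
    · exact row 3 ![0, 5, 1] ![2, 4, 5] (by decide) (by decide) (by decide)
    · exact row 4 ![3, 0, 1] ![0, 2, 4] (by decide) (by decide) (by decide)
    · exact row 5 ![0, 3, 1] ![1, 3, 5] (by decide) (by decide) (by decide)
  · fin_cases j
    · exact col 0 ![0, 2, 4] ![1, 4, 3] (by decide) (by decide) (by decide)
    · exact col 1 ![1, 2, 5] ![0, 2, 6] (by decide) (by decide) (by decide)
    · exact col 2 ![1, 3, 4] ![0, 1, 7] (by decide) (by decide) (by decide)
    · exact col 3 ![0, 2, 5] ![1, 4, 0] (by decide) (by decide) (by decide)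
    · exact col 4 ![0, 3, 4] ![1, 0, 5] (by decide) (by decide) (by decide)
    · exact col 5 ![0, 3, 5] ![1, 0, 4] (by decide) (by decide) (by decide)
    · exact col 6 ![1, 2, 4] ![0, 2, 1] (by decide) (by decide) (by decide)
    · exact col 7 ![1, 3, 5] ![0, 1, 2] (by decide) (by decide) (by decide)

namespace NonplanarOctahedronHyp

variable {z w : Fin 3 → ℝ} (h : NonplanarOctahedronHyp z w)
include h

/-- **"Hence, we must have `rank_psd O ≥ 5`"** (p12): every nonnegative `6 × 8` matrix `S` with the
octahedral zero pattern `nonplanarSupport` whose `5 × 5` block on rows `v₁,v₂,v₃,v₅,v₆` and columns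
`F₁₃₅,F₂₃₆,F₂₄₅,F₁₃₆,F₁₄₅` is a positive rescaling `r_i M_{ij} c_j` of `M` has NO psd factorization
of size `4`: rank-one factors (Prop. 3.2) would give a Hadamard square root of `S` of rank `≤ 4`
(Lemma 2.4 = FGPRT Prop. 6.2), whose rescaled block `N_{ij}/(√r_i √c_j)` is a Hadamard square root of
`M` of rank `≤ 4`. [cite: GouveiaRobinsonThomas2013, Thm. 4.8 proof (p12)] -/
theorem not_hasPsdFactorization_four {S : Matrix (Fin 6) (Fin 8) ℝ}
    (hS : ∀ i j, S i j = 0 ↔ nonplanarSupport i j = 0) {r c : Fin 5 → ℝ} (hr : ∀ i, 0 < r i)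
    (hc : ∀ j, 0 < c j)
    (hM : ∀ i j, S ((![0, 1, 2, 4, 5] : Fin 5 → Fin 6) i) ((![0, 1, 2, 3, 4] : Fin 5 → Fin 8) j) =
      r i * nonplanarOctahedronM z w i j * c j) :
    ¬ HasPsdFactorization S 4 := by
  rintro ⟨A, B, hA, hB, hAB⟩
  obtain ⟨hAr, hBr⟩ := factors_rank_le_one_of_nonplanarSupport hS A B hA hB hAB
  obtain ⟨N, hN, hrk⟩ := FawziEtAl2015_prop62_holds (Fin 6) (Fin 8) S 4
    ⟨A, B, fun i => ⟨hA i, hAr i⟩, fun j => ⟨hB j, hBr j⟩, hAB⟩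
  -- the rescaled block of `N` is a Hadamard square root of `M` of rank `≤ 4`
  let N' : Matrix (Fin 5) (Fin 5) ℝ :=
    N.submatrix (![0, 1, 2, 4, 5] : Fin 5 → Fin 6) (![0, 1, 2, 3, 4] : Fin 5 → Fin 8)
  let N'' : Matrix (Fin 5) (Fin 5) ℝ :=
    Matrix.diagonal (fun i => (Real.sqrt (r i))⁻¹) * N' * Matrix.diagonal (fun j => (Real.sqrt (c j))⁻¹)
  have hN'' : ∀ i j, N'' i j ^ 2 = nonplanarOctahedronM z w i j := by
    intro i j
    have hri : Real.sqrt (r i) ^ 2 = r i := Real.sq_sqrt (hr i).le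
    have hcj : Real.sqrt (c j) ^ 2 = c j := Real.sq_sqrt (hc j).le
    have hri0 : Real.sqrt (r i) ≠ 0 := Real.sqrt_ne_zero'.mpr (hr i)
    have hcj0 : Real.sqrt (c j) ≠ 0 := Real.sqrt_ne_zero'.mpr (hc j)
    have hsq : N' i j ^ 2 = r i * nonplanarOctahedronM z w i j * c j := by
      simp only [N', Matrix.submatrix_apply]
      rw [hN, hM]
    have hri' : r i ≠ 0 := ne_of_gt (hr i)
    have hcj' : c j ≠ 0 := ne_of_gt (hc j)
    have hentry : N'' i j = (Real.sqrt (r i))⁻¹ * N' i j * (Real.sqrt (c j))⁻¹ := by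
      simp only [N'', Matrix.mul_diagonal, Matrix.diagonal_mul]
    rw [hentry, mul_pow, mul_pow, hsq, inv_pow, inv_pow, hri, hcj]
    field_simp
  have hrk'' : N''.rank ≤ 4 :=
    calc N''.rank ≤ (Matrix.diagonal (fun i => (Real.sqrt (r i))⁻¹) * N').rank :=
          Matrix.rank_mul_le_left _ _
      _ ≤ N'.rank := Matrix.rank_mul_le_right _ _
      _ ≤ N.rank := Matrix.rank_submatrix_le N _ _
      _ ≤ 4 := hrk
  have := h.rank_eq_five_of_sq_eq N'' hN''
  omega

end NonplanarOctahedronHyp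

/-- **GRT Theorem 4.8, "only if" direction, second normal form** (p12, verbatim conclusion: "no choice
of `z₁,…,w₃` that is required to satisfy (4) and (5) can vanish on `f`. Hence, we must have
`rank_psd O ≥ 5`"): for the normal form `v₁=(0,0,1), v₂=0, v₃=(1,0,0), v₄=z, v₅=(0,1,0), v₆=w` of
an octahedron with no planarity other than possibly `{v₁,v₂,v₃,v₄}` (conditions (4), (5)), the
printed `5 × 5` matrix `M` has all its Hadamard square roots of rank `5`, and consequently no
nonnegative `6 × 8` matrix with the octahedral zero pattern containing a positive rescaling of `M`
as its `(v₁,v₂,v₃,v₅,v₆) × (F₁₃₅,F₂₃₆,F₂₄₅,F₁₃₆,F₁₄₅)` block — in particular the slack matrix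
`S_O` — has a psd factorization of size `4`. [cite: GouveiaRobinsonThomas2013, Thm. 4.8 (p11–p12)] -/
theorem GouveiaRobinsonThomas2013_thm48_converse {z w : Fin 3 → ℝ} (h : NonplanarOctahedronHyp z w) :
    (∀ N : Matrix (Fin 5) (Fin 5) ℝ, (∀ i j, N i j ^ 2 = nonplanarOctahedronM z w i j) → N.rank = 5) ∧
    ∀ (S : Matrix (Fin 6) (Fin 8) ℝ) (r c : Fin 5 → ℝ), (∀ i j, S i j = 0 ↔ nonplanarSupport i j = 0) →
      (∀ i, 0 < r i) → (∀ j, 0 < c j) →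
      (∀ i j, S ((![0, 1, 2, 4, 5] : Fin 5 → Fin 6) i) ((![0, 1, 2, 3, 4] : Fin 5 → Fin 8) j) =
        r i * nonplanarOctahedronM z w i j * c j) →
      ∀ k, HasPsdFactorization S k → 5 ≤ k := by
  refine ⟨h.rank_eq_five_of_sq_eq, fun S r c hS hr hc hM k hk => ?_⟩
  by_contra hlt
  exact h.not_hasPsdFactorization_four hS hr hc hM (hk.mono (by omega))

end Literature.Combinatorics.Optimization
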